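/-
Copyright: public-domain mathematics; typed transcription for the H21 Literature library (cell lit-balaban,
reader/typer seat r02 gen 5 = literature-prover-lit-balaban-r02-g5-0).

statement-level skeleton of published theorems with citation tags; proofs where landed; nothing here is a claim about the Yang–Mills mass gap

# Bałaban, *Propagators and renormalization transformations for lattice gauge theories. I*,
# Commun. Math. Phys. **95** (1984) 17–40 — the projection `P` is REPRESENTATION-INDEPENDENT:
# `B₁(B₁^*B₁)⁻¹B₁^* = B₂(B₂^*B₂)⁻¹B₂^*` whenever `B₁`, `B₂` factor through each other
# ((1.26) p.22 `P = Δ⁻¹Q′*(Q′Δ⁻²Q′*)⁻¹Q′Δ⁻¹` versus p.38 `P = G′Q′*(Q′G′²Q′*)⁻¹Q′G′`)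

[cite: Balaban1984PropagatorsI]  T. Bałaban, Commun. Math. Phys. 95 (1984) 17–40.  p. 22 (1.26) (P the orthogonal projection, written with Δ⁻¹);
p. 38 ll. 7–10: «They follow from the representation P = G′Q′*(Q′G′²Q′*)⁻¹Q′G′».

WHAT THIS MODULE ADDS (SKELETON row B5.Prop1.2 census (vii), the (1.132) kernel identification; typing-neutral linear algebra):
for matrices over `ℂ` on finite index types, `projOf B M := B * M * Bᴴ` with `M` a (two-sided) inverse of `Bᴴ * B`:
* `projOf_mul_self` (`P B = B`), `conjTranspose_mul_one_sub_projOf` (`Bᴴ(1 − P) = 0`), `projOf_mul_projOf`, `conjTranspose_projOf`;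
* **`projOf_eq_of_factor`**: if `B₂ = B₁ * T` and `B₁ = B₂ * S` (the two maps have the same range) then `P₁ = P₂` — the algebraic
  content of using BOTH printed representations of the same projection `P` (the tree's `B5Value126.PcT` is the Δ⁻¹ form, the (1.126)
  kernel machinery `B5DPD126Uniform.dpd` the G′ form).

HONEST SCOPE.  Elementary; nothing analytic.
-/
import Mathlib

open scoped Matrix
open Matrix

namespace Literature.MathematicalPhysics.QuantumFieldTheory.Balaban1983to89.B5ProjRangeIndep

/-! ## `P = B(B^*B)⁻¹B^*` depends only on the range of `B` -/

/-- `P_B := B (B^*B)⁻¹ B^*` with the inverse supplied as data `M`. [cite: Balaban1984PropagatorsI, (1.26) p.22] -/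
def projOf {X Y : Type} [Fintype Y] (B : Matrix X Y ℂ) (M : Matrix Y Y ℂ) : Matrix X X ℂ := B * M * Bᴴ

/-- `P_B B = B`. [cite: Balaban1984PropagatorsI, (1.26) p.22] -/
theorem projOf_mul_self {X Y : Type} [Fintype X] [Fintype Y] [DecidableEq Y] (B : Matrix X Y ℂ) (M : Matrix Y Y ℂ)
    (hM : M * (Bᴴ * B) = 1) : projOf B M * B = B := by
  unfold projOf
  rw [Matrix.mul_assoc (B * M), Matrix.mul_assoc B M, hM, Matrix.mul_one]

/-- `B^* (1 − P_B) = 0`. [cite: Balaban1984PropagatorsI, (1.26) p.22] -/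
theorem conjTranspose_mul_one_sub_projOf {X Y : Type} [Fintype X] [Fintype Y] [DecidableEq X] [DecidableEq Y] (B : Matrix X Y ℂ)
    (M : Matrix Y Y ℂ) (hM : (Bᴴ * B) * M = 1) : Bᴴ * (1 - projOf B M) = 0 := by
  unfold projOf
  rw [Matrix.mul_sub, Matrix.mul_one, ← Matrix.mul_assoc, ← Matrix.mul_assoc, hM, Matrix.one_mul, sub_self]

/-- **the projection is representation-independent**: if `B₂ = B₁T` and `B₁ = B₂S` then `B₁M₁B₁^* = B₂M₂B₂^*`
(`Mᵢ` two-sided inverses of `Bᵢ^*Bᵢ`). [cite: Balaban1984PropagatorsI, (1.26) p.22 with p.38 ll.7–10 (the two representations of P)] -/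
theorem projOf_eq_of_factor {X Y Y' : Type} [Fintype X] [Fintype Y] [Fintype Y'] [DecidableEq X] [DecidableEq Y] [DecidableEq Y']
    (B₁ : Matrix X Y ℂ) (B₂ : Matrix X Y' ℂ) (M₁ : Matrix Y Y ℂ) (M₂ : Matrix Y' Y' ℂ)
    (h₁r : (B₁ᴴ * B₁) * M₁ = 1) (h₂l : M₂ * (B₂ᴴ * B₂) = 1)
    (T : Matrix Y Y' ℂ) (S : Matrix Y' Y ℂ) (hT : B₂ = B₁ * T) (hS : B₁ = B₂ * S) :
    projOf B₁ M₁ = projOf B₂ M₂ := by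
  -- `P₂ B₁ = B₁`
  have hP2B1 : projOf B₂ M₂ * B₁ = B₁ := by
    rw [hS, ← Matrix.mul_assoc, projOf_mul_self B₂ M₂ h₂l]
  -- `P₂ P₁ = P₁`
  have hP2P1 : projOf B₂ M₂ * projOf B₁ M₁ = projOf B₁ M₁ := by
    show projOf B₂ M₂ * (B₁ * M₁ * B₁ᴴ) = B₁ * M₁ * B₁ᴴ
    rw [Matrix.mul_assoc B₁, ← Matrix.mul_assoc, hP2B1]
  -- `B₂^* (1 − P₁) = 0`
  have hB2 : B₂ᴴ * (1 - projOf B₁ M₁) = 0 := by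
    rw [hT, Matrix.conjTranspose_mul, Matrix.mul_assoc, conjTranspose_mul_one_sub_projOf B₁ M₁ h₁r, Matrix.mul_zero]
  -- `P₂ (1 − P₁) = 0`
  have hP2c : projOf B₂ M₂ * (1 - projOf B₁ M₁) = 0 := by
    show B₂ * M₂ * B₂ᴴ * (1 - projOf B₁ M₁) = 0
    rw [Matrix.mul_assoc, hB2, Matrix.mul_zero]
  -- assemble: `P₂ = P₂ P₁ + P₂ (1 − P₁) = P₁`
  have : projOf B₂ M₂ = projOf B₂ M₂ * projOf B₁ M₁ + projOf B₂ M₂ * (1 - projOf B₁ M₁) := by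
    rw [← Matrix.mul_add, add_sub_cancel, Matrix.mul_one]
  rw [this, hP2P1, hP2c, add_zero]

/-- `P_B` is idempotent. [cite: Balaban1984PropagatorsI, (1.26) p.22 («projection»)] -/
theorem projOf_mul_projOf {X Y : Type} [Fintype X] [Fintype Y] [DecidableEq Y] (B : Matrix X Y ℂ) (M : Matrix Y Y ℂ)
    (hM : M * (Bᴴ * B) = 1) : projOf B M * projOf B M = projOf B M := by
  show projOf B M * (B * M * Bᴴ) = B * M * Bᴴ
  rw [Matrix.mul_assoc B, ← Matrix.mul_assoc, projOf_mul_self B M hM]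

/-- `P_B` is self-adjoint when `M` is. [cite: Balaban1984PropagatorsI, (1.26) p.22 («orthogonal projection»)] -/
theorem conjTranspose_projOf {X Y : Type} [Fintype Y] (B : Matrix X Y ℂ) (M : Matrix Y Y ℂ) (hM : Mᴴ = M) :
    (projOf B M)ᴴ = projOf B M := by
  unfold projOf
  rw [Matrix.conjTranspose_mul, Matrix.conjTranspose_mul, Matrix.conjTranspose_conjTranspose, hM, Matrix.mul_assoc]

/-! ## v1.1 (§2) Orthogonal blocks: `P_{[B | C]} = P_B + P_C` when `B^*C = 0` — the constant mode of the G′-representation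

Sect. C p.22: `Δ⁻¹` is the inverse on the orthogonal complement of the constants (0 on constants), so `Range(G′Q′^*) =
Range(Δ⁻¹Q′^*) ⊕ ℂ·1`; with `projOf_eq_of_factor` this gives `P_{G′} = P_{Δ⁻¹} + P_const`, and `∂P∂^*` is the same for both
representations because `∂1 = 0`. -/

/-- the Gram matrix of orthogonal column blocks is block diagonal, so `diag(M_B, M_C)` inverts it (right).
[cite: Balaban1984PropagatorsI, Sect. C p.22 (Δ⁻¹ := 0 on constants), (1.26)] -/
theorem gram_fromCols_mul {X Y Z : Type} [Fintype X] [Fintype Y] [Fintype Z] [DecidableEq Y] [DecidableEq Z]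
    (B : Matrix X Y ℂ) (C : Matrix X Z ℂ) (MB : Matrix Y Y ℂ) (MC : Matrix Z Z ℂ) (hBC : Bᴴ * C = 0)
    (hB : (Bᴴ * B) * MB = 1) (hC : (Cᴴ * C) * MC = 1) :
    ((Matrix.fromCols B C)ᴴ * Matrix.fromCols B C) * Matrix.fromBlocks MB 0 0 MC = 1 := by
  have hCB : Cᴴ * B = 0 := by
    have := congrArg Matrix.conjTranspose hBC
    rwa [Matrix.conjTranspose_mul, Matrix.conjTranspose_conjTranspose, Matrix.conjTranspose_zero] at this
  rw [Matrix.conjTranspose_fromCols_eq_fromRows_conjTranspose, Matrix.fromRows_mul_fromCols, Matrix.fromBlocks_multiply,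
    hBC, hCB, hB, hC]
  simp [Matrix.fromBlocks_one]

/-- the same on the left. [cite: Balaban1984PropagatorsI, Sect. C p.22, (1.26)] -/
theorem mul_gram_fromCols {X Y Z : Type} [Fintype X] [Fintype Y] [Fintype Z] [DecidableEq Y] [DecidableEq Z]
    (B : Matrix X Y ℂ) (C : Matrix X Z ℂ) (MB : Matrix Y Y ℂ) (MC : Matrix Z Z ℂ) (hBC : Bᴴ * C = 0)
    (hB : MB * (Bᴴ * B) = 1) (hC : MC * (Cᴴ * C) = 1) :
    Matrix.fromBlocks MB 0 0 MC * ((Matrix.fromCols B C)ᴴ * Matrix.fromCols B C) = 1 := by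
  have hCB : Cᴴ * B = 0 := by
    have := congrArg Matrix.conjTranspose hBC
    rwa [Matrix.conjTranspose_mul, Matrix.conjTranspose_conjTranspose, Matrix.conjTranspose_zero] at this
  rw [Matrix.conjTranspose_fromCols_eq_fromRows_conjTranspose, Matrix.fromRows_mul_fromCols, Matrix.fromBlocks_multiply,
    hBC, hCB, hB, hC]
  simp [Matrix.fromBlocks_one]

/-- **orthogonal blocks add**: `P_{[B | C]} = P_B + P_C` (with the block-diagonal inverse).
[cite: Balaban1984PropagatorsI, Sect. C p.22 (the constant mode), (1.26)] -/
theorem projOf_fromCols {X Y Z : Type} [Fintype Y] [Fintype Z] (B : Matrix X Y ℂ) (C : Matrix X Z ℂ) (MB : Matrix Y Y ℂ)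
    (MC : Matrix Z Z ℂ) :
    projOf (Matrix.fromCols B C) (Matrix.fromBlocks MB 0 0 MC) = projOf B MB + projOf C MC := by
  unfold projOf
  rw [Matrix.fromCols_mul_fromBlocks, Matrix.mul_zero, Matrix.mul_zero, add_zero, zero_add,
    Matrix.conjTranspose_fromCols_eq_fromRows_conjTranspose, Matrix.fromCols_mul_fromRows]

/-- **the two printed representations of `P` differ by the extra orthogonal block**: if `B₂` (e.g. `G′Q′^*`) and `[B₁ | C]`
(e.g. `[Δ⁻¹Q′^* | 1]`) factor through each other and `B₁^*C = 0`, then `P_{B₂} = P_{B₁} + P_C`.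
[cite: Balaban1984PropagatorsI, (1.26) p.22, Sect. C p.22, p.38 ll.7–10] -/
theorem projOf_eq_add_of_factor {X Y Y' Z : Type} [Fintype X] [Fintype Y] [Fintype Y'] [Fintype Z] [DecidableEq X]
    [DecidableEq Y] [DecidableEq Y'] [DecidableEq Z]
    (B₁ : Matrix X Y ℂ) (C : Matrix X Z ℂ) (B₂ : Matrix X Y' ℂ) (M₁ : Matrix Y Y ℂ) (MC : Matrix Z Z ℂ) (M₂ : Matrix Y' Y' ℂ)
    (hBC : B₁ᴴ * C = 0) (h₁ : (B₁ᴴ * B₁) * M₁ = 1) (hC : (Cᴴ * C) * MC = 1) (h₂ : M₂ * (B₂ᴴ * B₂) = 1)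
    (T : Matrix (Y ⊕ Z) Y' ℂ) (S : Matrix Y' (Y ⊕ Z) ℂ) (hT : B₂ = Matrix.fromCols B₁ C * T) (hS : Matrix.fromCols B₁ C = B₂ * S) :
    projOf B₂ M₂ = projOf B₁ M₁ + projOf C MC := by
  rw [← projOf_fromCols]
  exact (projOf_eq_of_factor (Matrix.fromCols B₁ C) B₂ (Matrix.fromBlocks M₁ 0 0 MC) M₂
    (gram_fromCols_mul B₁ C M₁ MC hBC h₁ hC) h₂ T S hT hS).symm

end Literature.MathematicalPhysics.QuantumFieldTheory.Balaban1983to89.B5ProjRangeIndep
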